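import Summits.ResolutionOfSingularities.ResolutionOfSingularities.Theorems.SoloBlindFrobeniusSandwich
import Mathlib.AlgebraicGeometry.Morphisms.ClosedImmersion
import HarnessLib
import HarnessLib.Audit.Tags

/-!
# Lemma B of the Frobenius-sandwich normal form: the base of the tower

Kernel proof of the obligation node `SoloBlind.BaseStep` of
`Theorems/SoloBlindFrobeniusSandwich.lean` (solo-blind line, Theorem A): a purely inseparable
alteration `π : Y ⟶ X` of exponent `1` (proper, surjective, and over a dense open `U ⊆ X`
finite with every `π^*` on sections surjective) between integral schemes, with `Y` regular, is a
resolution of singularities of `X`.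

Proof. Over `U`, `π ∣_ U` is affine (finite) and surjective on sections over every open, hence
a closed immersion (Mathlib `isClosedImmersion_iff_isAffineHom`); it is surjective (restriction
of a surjective morphism) onto the reduced scheme `U`, hence an isomorphism
(`isIso_of_isClosedImmersion_of_surjective`). The preimage `π ⁻¹ U` is a non-empty open subset
of the irreducible space `Y`, hence dense. So `π` is proper and birational with regular source.

References: solo-blind notes `paper/paper.md`, §2 Lemma B. [folklore]
-/

noncomputable section

open CategoryTheory AlgebraicGeometry TopologicalSpace
open Literature.AlgebraicGeometry.Resolution

namespace Summit.ResolutionOfSingularities.ResolutionOfSingularities.Theorems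

universe u

/-- A finite morphism which is purely inseparable of exponent `1` on sections (every `f.app V`
is surjective) is a closed immersion. [folklore] -/
theorem SoloBlind.isClosedImmersion_of_exponent_one {X Y : Scheme.{u}} (f : X ⟶ Y) [IsFinite f]
    (h : IsPurelyInseparableOfExponent 1 f) : IsClosedImmersion f := by
  rw [isClosedImmersion_iff_isAffineHom]
  refine ⟨inferInstance, fun V _ a => ?_⟩
  obtain ⟨b, hb⟩ := h V a
  exact ⟨b, by simpa using hb⟩

/-- A finite surjective morphism onto a reduced scheme which is purely inseparable of exponent
`1` on sections is an isomorphism. [folklore] -/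
theorem SoloBlind.isIso_of_exponent_one {X Y : Scheme.{u}} (f : X ⟶ Y) [IsFinite f]
    [Surjective f] [IsReduced Y] (h : IsPurelyInseparableOfExponent 1 f) : IsIso f :=
  haveI := SoloBlind.isClosedImmersion_of_exponent_one f h
  isIso_of_isClosedImmersion_of_surjective f

/-- A purely inseparable alteration of exponent `1` between integral schemes is birational: it is
an isomorphism over its dense open of finiteness, whose preimage is a non-empty open of the
irreducible source. [folklore] -/
theorem SoloBlind.isBirational_of_alterationOfExponent_one {X Y : Scheme.{u}} (π : Y ⟶ X)
    [IsIntegral X] [IsIntegral Y] (hπ : IsPurelyInseparableAlterationOfExponent 1 π) :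
    IsBirational π := by
  obtain ⟨_, hsurj, U, hU, hfin, hrad⟩ := hπ
  haveI := hsurj
  haveI := hfin
  haveI : Surjective (π ∣_ U) := IsZariskiLocalAtTarget.restrict (P := @Surjective) hsurj U
  refine ⟨U, hU, ?_, SoloBlind.isIso_of_exponent_one (π ∣_ U) hrad⟩
  -- the preimage is a non-empty open subset of the irreducible `Y`, hence dense
  obtain ⟨x, hx⟩ := hU.nonempty
  obtain ⟨y, rfl⟩ := π.surjective x
  exact (π ⁻¹ᵁ U).isOpen.dense ⟨y, hx⟩

/-- **Lemma B** (base of the Frobenius-sandwich tower), kernel proof of the obligation node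
`SoloBlind.BaseStep`: a purely inseparable alteration of exponent `1` from a regular integral
scheme onto an integral scheme is a resolution of singularities of the target. [folklore] -/
theorem SoloBlind.BaseStep_holds : SoloBlind.BaseStep.{u} := by
  intro X Y π hX hY hYreg hπ
  haveI := hX
  haveI := hY
  exact ⟨Y, π, ⟨hπ.1, SoloBlind.isBirational_of_alterationOfExponent_one π hπ, hYreg⟩⟩

end Summit.ResolutionOfSingularities.ResolutionOfSingularities.Theorems

end
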